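import Mathlib.Analysis.SpecialFunctions.ExpDeriv
import Literature.Probability.LatticeModels.UrsellMonotonicityProofs
import HarnessLib

/-!
# Camia–Jiang–Newman 2023: the derivative of Gibbs averages and Ursell functions in one coupling

Topic `Literature/Probability/LatticeModels`; sibling PROOF file of `UrsellMonotonicity.lean`
(named fact `CamiaJiangNewman2023_thm1`, CJN Thm 1) and `UrsellMonotonicityProofs.lean`
(differentiability in one coupling).  This file computes the derivatives explicitly — the first
step of the proof of CJN Theorem 1 (CJN eq. (20), p. 5 of arXiv:2207.12247: "From (2), we have
`∂u_{2k}/∂J_{uv} = Σ_P (-1)^{|P|-1}(|P|-1)! Σ_{Q∈P} [⟨σ_Qσ_uσ_v⟩ - ⟨σ_Q⟩⟨σ_uσ_v⟩] ∏_{P≠Q} ⟨σ_P⟩`"):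

* `PairIsing.weight_setCoupling` — perturbing the entry `(u₀,v₀)` of the coupling matrix multiplies
  every Boltzmann weight by `exp((t - c u₀ v₀) σ_{u₀}σ_{v₀})`;
* `PairIsing.hasDerivAt_weight_setCoupling`, `hasDerivAt_avg_setCoupling`, `deriv_avg_setCoupling` —
  the **fluctuation formula** `d/dt ⟨f⟩_{c_t} = ⟨f σ_{u₀}σ_{v₀}⟩_{c_t} - ⟨f⟩_{c_t}⟨σ_{u₀}σ_{v₀}⟩_{c_t}`
  (`c_t = setCoupling c u₀ v₀ t`);
* `PairIsing.hasDerivAt_ursell_setCoupling`, `deriv_ursell_setCoupling` — CJN eq. (20): the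
  derivative of the Ursell function `u_n(c_t; j)` is the partition sum with one block factor
  replaced by its covariance with `σ_{u₀}σ_{v₀}` (Leibniz rule over the blocks).

No definitions, no named facts.

## References

* [CamiaJiangNewman2023] F. Camia, J. Jiang, C. M. Newman, *Monotonicity of Ursell functions in the
  Ising model*, Comm. Math. Phys. 401 (2023) 2459–2482, arXiv:2207.12247, §2, eq. (20) (read via
  `lit read arxiv:2207.12247`, chunk p0005).
-/

noncomputable section

open Finset

namespace Literature.Probability.LatticeModels

namespace PairIsing

variable {ι : Type*} [Fintype ι] [DecidableEq ι]

/-! ### The weights along `t ↦ setCoupling c u₀ v₀ t` -/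

/-- The exponent of the Boltzmann weight is affine in the perturbed entry:
`Σ_{a,b} (setCoupling c u₀ v₀ t)_{ab} σ_aσ_b = Σ_{a,b} c_{ab}σ_aσ_b + (t - c_{u₀v₀}) σ_{u₀}σ_{v₀}`.
[folklore] -/
theorem sum_sum_setCoupling_mul_spin (c : ι → ι → ℝ) (u₀ v₀ : ι) (t : ℝ) (ρ : SpinConfig ι) :
    ∑ a, ∑ b, setCoupling c u₀ v₀ t a b * (spinAt a ρ * spinAt b ρ) =
      (∑ a, ∑ b, c a b * (spinAt a ρ * spinAt b ρ)) +
        (t - c u₀ v₀) * (spinAt u₀ ρ * spinAt v₀ ρ) := by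
  have h : ∀ a b, setCoupling c u₀ v₀ t a b * (spinAt a ρ * spinAt b ρ) =
      c a b * (spinAt a ρ * spinAt b ρ) +
        (if a = u₀ ∧ b = v₀ then (t - c u₀ v₀) * (spinAt u₀ ρ * spinAt v₀ ρ) else 0) := by
    intro a b
    unfold setCoupling
    by_cases hab : a = u₀ ∧ b = v₀
    · obtain ⟨rfl, rfl⟩ := hab
      rw [if_pos ⟨rfl, rfl⟩, if_pos ⟨rfl, rfl⟩]
      ring
    · rw [if_neg hab, if_neg hab, add_zero]
  simp_rw [h, Finset.sum_add_distrib]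
  congr 1
  have inner : ∀ a, (∑ b, if a = u₀ ∧ b = v₀ then (t - c u₀ v₀) * (spinAt u₀ ρ * spinAt v₀ ρ)
      else (0 : ℝ)) = if a = u₀ then (t - c u₀ v₀) * (spinAt u₀ ρ * spinAt v₀ ρ) else 0 := by
    intro a
    by_cases ha : a = u₀
    · simp [ha]
    · simp [ha]
  simp_rw [inner]
  simp

/-- **Perturbing one coupling entry tilts every weight by the bond variable**:
`w_{c_t}(σ) = w_c(σ) · exp((t - c_{u₀v₀}) σ_{u₀}σ_{v₀})`. [folklore] -/
theorem weight_setCoupling (c : ι → ι → ℝ) (u₀ v₀ : ι) (t : ℝ) (ρ : SpinConfig ι) :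
    weight (setCoupling c u₀ v₀ t) ρ =
      weight c ρ * Real.exp ((t - c u₀ v₀) * (spinAt u₀ ρ * spinAt v₀ ρ)) := by
  rw [weight, weight, sum_sum_setCoupling_mul_spin, Real.exp_add]

/-- `d/dt w_{c_t}(σ) = σ_{u₀}σ_{v₀} · w_{c_t}(σ)`. [folklore] -/
theorem hasDerivAt_weight_setCoupling (c : ι → ι → ℝ) (u₀ v₀ : ι) (ρ : SpinConfig ι) (t : ℝ) :
    HasDerivAt (fun t => weight (setCoupling c u₀ v₀ t) ρ)
      (spinAt u₀ ρ * spinAt v₀ ρ * weight (setCoupling c u₀ v₀ t) ρ) t := by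
  have hfun : (fun t => weight (setCoupling c u₀ v₀ t) ρ) =
      fun t => weight c ρ * Real.exp ((t - c u₀ v₀) * (spinAt u₀ ρ * spinAt v₀ ρ)) :=
    funext fun t => weight_setCoupling c u₀ v₀ t ρ
  rw [hfun]
  have h1 : HasDerivAt (fun t : ℝ => (t - c u₀ v₀) * (spinAt u₀ ρ * spinAt v₀ ρ))
      (spinAt u₀ ρ * spinAt v₀ ρ) t := by
    simpa using ((hasDerivAt_id t).sub_const (c u₀ v₀)).mul_const (spinAt u₀ ρ * spinAt v₀ ρ)
  have h2 := (h1.exp).const_mul (weight c ρ)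
  refine h2.congr_deriv ?_
  rw [weight_setCoupling]
  ring

/-- Derivative of a weighted configuration sum `Σ_σ f(σ) w_{c_t}(σ)`. [folklore] -/
theorem hasDerivAt_sum_mul_weight_setCoupling (c : ι → ι → ℝ) (u₀ v₀ : ι)
    (f : SpinConfig ι → ℝ) (t : ℝ) :
    HasDerivAt (fun t => ∑ ρ, f ρ * weight (setCoupling c u₀ v₀ t) ρ)
      (∑ ρ, f ρ * (spinAt u₀ ρ * spinAt v₀ ρ) * weight (setCoupling c u₀ v₀ t) ρ) t := by
  have h := HasDerivAt.fun_sum (u := (univ : Finset (SpinConfig ι))) (x := t)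
    (A := fun ρ t => f ρ * weight (setCoupling c u₀ v₀ t) ρ)
    (A' := fun ρ => f ρ * (spinAt u₀ ρ * spinAt v₀ ρ * weight (setCoupling c u₀ v₀ t) ρ))
    (fun ρ _ => (hasDerivAt_weight_setCoupling c u₀ v₀ ρ t).const_mul (f ρ))
  exact h.congr_deriv (Finset.sum_congr rfl fun ρ _ => by ring)

/-! ### The fluctuation formula for Gibbs averages -/

/-- **The fluctuation (covariance) formula**: for the one-parameter family
`c_t = setCoupling c u₀ v₀ t`,
`d/dt ⟨f⟩_{c_t} = ⟨f σ_{u₀}σ_{v₀}⟩_{c_t} - ⟨f⟩_{c_t} ⟨σ_{u₀}σ_{v₀}⟩_{c_t}`.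
[cite: CamiaJiangNewman2023, §2 eq. (20)] -/
theorem hasDerivAt_avg_setCoupling (c : ι → ι → ℝ) (u₀ v₀ : ι) (f : SpinConfig ι → ℝ) (t : ℝ) :
    HasDerivAt (fun t => avg (setCoupling c u₀ v₀ t) f)
      (avg (setCoupling c u₀ v₀ t) (fun ρ => f ρ * (spinAt u₀ ρ * spinAt v₀ ρ)) -
        avg (setCoupling c u₀ v₀ t) f *
          avg (setCoupling c u₀ v₀ t) (fun ρ => spinAt u₀ ρ * spinAt v₀ ρ)) t := by
  have hN := hasDerivAt_sum_mul_weight_setCoupling c u₀ v₀ f t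
  have hD := hasDerivAt_sum_mul_weight_setCoupling c u₀ v₀ (fun _ => 1) t
  simp only [one_mul] at hD
  have hD0 : (∑ ρ, weight (setCoupling c u₀ v₀ t) ρ) ≠ 0 := (sum_weight_pos _).ne'
  have h := hN.div hD hD0
  change HasDerivAt (fun t => (∑ ρ, f ρ * weight (setCoupling c u₀ v₀ t) ρ) /
      ∑ ρ, weight (setCoupling c u₀ v₀ t) ρ) _ t
  refine h.congr_deriv ?_
  simp only [avg]
  field_simp

/-- **The fluctuation formula at the unperturbed point**:
`d/dt|_{t = c_{u₀v₀}} ⟨f⟩_{c_t} = ⟨f σ_{u₀}σ_{v₀}⟩_c - ⟨f⟩_c ⟨σ_{u₀}σ_{v₀}⟩_c`.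
[cite: CamiaJiangNewman2023, §2 eq. (20)] -/
theorem deriv_avg_setCoupling (c : ι → ι → ℝ) (u₀ v₀ : ι) (f : SpinConfig ι → ℝ) :
    deriv (fun t => avg (setCoupling c u₀ v₀ t) f) (c u₀ v₀) =
      avg c (fun ρ => f ρ * (spinAt u₀ ρ * spinAt v₀ ρ)) -
        avg c f * avg c (fun ρ => spinAt u₀ ρ * spinAt v₀ ρ) := by
  have h := (hasDerivAt_avg_setCoupling c u₀ v₀ f (c u₀ v₀)).deriv
  simpa only [setCoupling_self] using h

/-! ### CJN eq. (20): the derivative of the Ursell function -/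

/-- **CJN eq. (20), along the family `c_t`**: the derivative of
`u_n(c_t; j) = Σ_P (-1)^{|P|-1}(|P|-1)! ∏_{B∈P} ⟨σ_B⟩_{c_t}` (`σ_B = ∏_{i∈B} σ_{j i}`) is
`Σ_P (-1)^{|P|-1}(|P|-1)! Σ_{Q∈P} (∏_{B∈P, B≠Q} ⟨σ_B⟩_{c_t}) ·
  (⟨σ_Q σ_{u₀}σ_{v₀}⟩_{c_t} - ⟨σ_Q⟩_{c_t}⟨σ_{u₀}σ_{v₀}⟩_{c_t})` (Leibniz rule over the blocks and the
fluctuation formula). [cite: CamiaJiangNewman2023, §2 eq. (20)] -/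
theorem hasDerivAt_ursell_setCoupling (c : ι → ι → ℝ) (u₀ v₀ : ι) {n : ℕ} (j : Fin n → ι)
    (t : ℝ) :
    HasDerivAt (fun t => ursell (setCoupling c u₀ v₀ t) j)
      (∑ P : Finpartition (univ : Finset (Fin n)),
        (-1 : ℝ) ^ (P.parts.card - 1) * ((P.parts.card - 1).factorial : ℝ) *
          ∑ Q ∈ P.parts,
            (∏ B ∈ P.parts.erase Q,
                avg (setCoupling c u₀ v₀ t) (fun σ => ∏ i ∈ B, spinAt (j i) σ)) *
              (avg (setCoupling c u₀ v₀ t)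
                  (fun σ => (∏ i ∈ Q, spinAt (j i) σ) * (spinAt u₀ σ * spinAt v₀ σ)) -
                avg (setCoupling c u₀ v₀ t) (fun σ => ∏ i ∈ Q, spinAt (j i) σ) *
                  avg (setCoupling c u₀ v₀ t) (fun σ => spinAt u₀ σ * spinAt v₀ σ))) t := by
  unfold ursell
  refine HasDerivAt.fun_sum fun P _ => ?_
  refine HasDerivAt.const_mul _ ?_
  have h := HasDerivAt.fun_finsetProd (u := P.parts) (x := t)
    (f := fun B t => avg (setCoupling c u₀ v₀ t) (fun σ => ∏ i ∈ B, spinAt (j i) σ))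
    (f' := fun Q => avg (setCoupling c u₀ v₀ t)
        (fun σ => (∏ i ∈ Q, spinAt (j i) σ) * (spinAt u₀ σ * spinAt v₀ σ)) -
      avg (setCoupling c u₀ v₀ t) (fun σ => ∏ i ∈ Q, spinAt (j i) σ) *
        avg (setCoupling c u₀ v₀ t) (fun σ => spinAt u₀ σ * spinAt v₀ σ))
    (fun Q _ => hasDerivAt_avg_setCoupling c u₀ v₀ _ t)
  simpa only [smul_eq_mul] using h

/-- **CJN eq. (20)**: `d/dt|_{t = c_{u₀v₀}} u_n(setCoupling c u₀ v₀ t; j)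
= Σ_P (-1)^{|P|-1}(|P|-1)! Σ_{Q∈P} (∏_{B≠Q} ⟨σ_B⟩_c)(⟨σ_Qσ_{u₀}σ_{v₀}⟩_c - ⟨σ_Q⟩_c⟨σ_{u₀}σ_{v₀}⟩_c)`.
[cite: CamiaJiangNewman2023, §2 eq. (20)] -/
theorem deriv_ursell_setCoupling (c : ι → ι → ℝ) (u₀ v₀ : ι) {n : ℕ} (j : Fin n → ι) :
    deriv (fun t => ursell (setCoupling c u₀ v₀ t) j) (c u₀ v₀) =
      ∑ P : Finpartition (univ : Finset (Fin n)),
        (-1 : ℝ) ^ (P.parts.card - 1) * ((P.parts.card - 1).factorial : ℝ) *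
          ∑ Q ∈ P.parts,
            (∏ B ∈ P.parts.erase Q, avg c (fun σ => ∏ i ∈ B, spinAt (j i) σ)) *
              (avg c (fun σ => (∏ i ∈ Q, spinAt (j i) σ) * (spinAt u₀ σ * spinAt v₀ σ)) -
                avg c (fun σ => ∏ i ∈ Q, spinAt (j i) σ) *
                  avg c (fun σ => spinAt u₀ σ * spinAt v₀ σ)) := by
  have h := (hasDerivAt_ursell_setCoupling c u₀ v₀ j (c u₀ v₀)).deriv
  simpa only [setCoupling_self] using h

end PairIsing

end Literature.Probability.LatticeModels
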